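import Summits.AtomisticToContinuum.Crystallization.Theses.ChessboardParticlePlanes
import Literature.MathematicalPhysics.StatisticalMechanics.LocalLimitOfGroundStates
import Literature.MathematicalPhysics.StatisticalMechanics.LennardJonesClusters

/-!
# Crux `PeriodicWindows` (stmt-AtomisticToContinuum-3240), line `Sketch` — the rotated hull (API)

Helpers for the lead skeleton `PeriodicWindowsSketch` (route `ChessboardParticlePlanes`). The stubs of
the line speak about the ROTATED HULL of a fixed sequence `x` of finite configurations: the sets
`X ⊆ ℝ³` for which there are a strictly increasing `σ`, translations `τ j` and linear isometry
equivalences `A j` with `A j (x (σ j) ·) + τ j → X` in the local two-way matching sense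
(`BallMatch ε R 0 (range …) X` eventually in `j`, for every `R` and `ε > 0`). No definition is
introduced (the stubs are registered in unfolded form); the clause is written out in every statement.

* `rotHull_image` — the rotated hull is invariant under `p ↦ B p + v` (`B` a linear isometry
  equivalence).
* `rotHull_of_eventually_ballMatch` — the rotated hull is CLOSED under local limits (diagonal
  argument, as `IsLocalLimitOfGroundStates.of_eventually_ballMatch`).
* `rotHull_isLocalLimitOfGroundStates` — for a sequence of Lennard-Jones ground states the rotated
  hull lies in the class `𝔏` (`IsLocalLimitOfGroundStates lennardJones 3`), whence
  `rotHull_le_dist` / `rotHull_uniformlyDiscrete` (the minimal distance of ground states passes to it).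
-/

noncomputable section

namespace Summit.AtomisticToContinuum.Crystallization.Theorems.PeriodicWindowsSketch

open Literature.MathematicalPhysics.StatisticalMechanics Filter Metric

/-- `‖a‖ ≤ ‖b‖ + dist a b`. -/
private theorem norm_le_norm_add_dist' (a b : EuclideanSpace ℝ (Fin 3)) : ‖a‖ ≤ ‖b‖ + dist a b := by
  rw [dist_eq_norm]
  linarith [norm_sub_norm_le a b]

/-- **Invariance of the rotated hull under rigid motions.** If `X` is a local matching limit of
`A j (x (σ j) ·) + τ j`, then `B '' X + v` is the local matching limit of
`(B ∘ A j) (x (σ j) ·) + (B (τ j) + v)`. -/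
theorem rotHull_image (x : (N : ℕ) → (Fin N → EuclideanSpace ℝ (Fin 3)))
    {X : Set (EuclideanSpace ℝ (Fin 3))}
    (hX : ∃ (σ : ℕ → ℕ) (τ : ℕ → EuclideanSpace ℝ (Fin 3))
        (A : ℕ → (EuclideanSpace ℝ (Fin 3) ≃ₗᵢ[ℝ] EuclideanSpace ℝ (Fin 3))),
      StrictMono σ ∧ ∀ R ε : ℝ, 0 < ε → ∀ᶠ j in Filter.atTop,
        BallMatch ε R 0 (Set.range fun i => A j (x (σ j) i) + τ j) X)
    (B : EuclideanSpace ℝ (Fin 3) ≃ₗᵢ[ℝ] EuclideanSpace ℝ (Fin 3)) (v : EuclideanSpace ℝ (Fin 3)) :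
    ∃ (σ : ℕ → ℕ) (τ : ℕ → EuclideanSpace ℝ (Fin 3))
        (A : ℕ → (EuclideanSpace ℝ (Fin 3) ≃ₗᵢ[ℝ] EuclideanSpace ℝ (Fin 3))),
      StrictMono σ ∧ ∀ R ε : ℝ, 0 < ε → ∀ᶠ j in Filter.atTop,
        BallMatch ε R 0 (Set.range fun i => A j (x (σ j) i) + τ j) ((fun p => B p + v) '' X) := by
  obtain ⟨σ, τ, A, hσ, hlim⟩ := hX
  refine ⟨σ, fun j => B (τ j) + v, fun j => (A j).trans B, hσ, fun R ε hε => ?_⟩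
  filter_upwards [hlim (R + ‖v‖) ε hε] with j hj
  obtain ⟨h1, h2⟩ := hj
  -- the moved configuration is the image of the old one under `p ↦ B p + v`
  have hcfg : ∀ i, ((A j).trans B) (x (σ j) i) + (B (τ j) + v) = B (A j (x (σ j) i) + τ j) + v := by
    intro i
    simp only [LinearIsometryEquiv.trans_apply, map_add]
    abel
  have hback : ∀ p : EuclideanSpace ℝ (Fin 3), dist (B p + v) 0 ≤ R → dist p 0 ≤ R + ‖v‖ := by
    intro p hp
    rw [dist_zero_right] at hp ⊢
    have : ‖B p‖ ≤ ‖B p + v‖ + ‖v‖ := by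
      have := norm_le_norm_add_dist' (B p) (B p + v)
      rwa [dist_eq_norm, sub_add_cancel_left, norm_neg] at this
    rw [B.norm_map] at this
    linarith
  refine ⟨?_, ?_⟩
  · rintro _ ⟨p, hp, rfl⟩ hpR
    dsimp only at hpR ⊢
    obtain ⟨a, ⟨i, rfl⟩, hap⟩ := h1 p hp (hback p hpR)
    refine ⟨_, ⟨i, rfl⟩, ?_⟩
    dsimp only
    rw [hcfg, dist_add_right, B.dist_map]
    exact hap
  · rintro _ ⟨i, rfl⟩ hiR
    dsimp only at hiR ⊢
    rw [hcfg] at hiR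
    obtain ⟨s, hs, his⟩ := h2 _ ⟨i, rfl⟩ (hback _ hiR)
    refine ⟨B s + v, ⟨s, hs, rfl⟩, ?_⟩
    rw [hcfg, dist_add_right, B.dist_map]
    exact his

/-- **The rotated hull is closed under local limits.** If every `Xs k` is in the rotated hull of
`x` and `Xs k → X` locally (eventually `BallMatch ε R 0 (Xs k) X` for every `R`, `ε > 0`), then `X`
is in the rotated hull of `x` (diagonal argument: match `Xs k` at scale `(k, 1/(k+1))` by the
`j_k`-th term of its own witness sequence, with particle numbers `σ_k (j_k)` strictly increasing). -/
theorem rotHull_of_eventually_ballMatch (x : (N : ℕ) → (Fin N → EuclideanSpace ℝ (Fin 3)))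
    {Xs : ℕ → Set (EuclideanSpace ℝ (Fin 3))} {X : Set (EuclideanSpace ℝ (Fin 3))}
    (hXs : ∀ k, ∃ (σ : ℕ → ℕ) (τ : ℕ → EuclideanSpace ℝ (Fin 3))
        (A : ℕ → (EuclideanSpace ℝ (Fin 3) ≃ₗᵢ[ℝ] EuclideanSpace ℝ (Fin 3))),
      StrictMono σ ∧ ∀ R ε : ℝ, 0 < ε → ∀ᶠ j in Filter.atTop,
        BallMatch ε R 0 (Set.range fun i => A j (x (σ j) i) + τ j) (Xs k))
    (hlim : ∀ R ε : ℝ, 0 < ε → ∀ᶠ k in Filter.atTop, BallMatch ε R 0 (Xs k) X) :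
    ∃ (σ : ℕ → ℕ) (τ : ℕ → EuclideanSpace ℝ (Fin 3))
        (A : ℕ → (EuclideanSpace ℝ (Fin 3) ≃ₗᵢ[ℝ] EuclideanSpace ℝ (Fin 3))),
      StrictMono σ ∧ ∀ R ε : ℝ, 0 < ε → ∀ᶠ j in Filter.atTop,
        BallMatch ε R 0 (Set.range fun i => A j (x (σ j) i) + τ j) X := by
  classical
  choose σ τ A hσ hmatch using hXs
  -- thresholds `J k` for the matching of `Xs k` at scale `(k, 1/(k+1))`
  have hth := fun k : ℕ =>
    Filter.eventually_atTop.1 (hmatch k (k : ℝ) (1 / ((k : ℝ) + 1)) (by positivity))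
  choose J hJ using hth
  -- diagonal indices `j 0 = J 0`, `j (k+1) = max (J (k+1)) (σ k (j k) + 1)`
  obtain ⟨jd, hjjJ, hjsucc⟩ :
      ∃ jd : ℕ → ℕ, (∀ k, J k ≤ jd k) ∧ ∀ k, σ k (jd k) + 1 ≤ jd (k + 1) := by
    refine ⟨fun k => Nat.rec (motive := fun _ => ℕ) (J 0)
        (fun k jk => max (J (k + 1)) (σ k jk + 1)) k,
      fun k => ?_, fun k => le_max_right _ _⟩
    cases k with
    | zero => exact le_rfl
    | succ k => exact le_max_left _ _
  have hNk : StrictMono fun k => σ k (jd k) := strictMono_nat_of_lt_succ fun k =>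
    calc σ k (jd k) < σ k (jd k) + 1 := Nat.lt_succ_self _
      _ ≤ jd (k + 1) := hjsucc k
      _ ≤ σ (k + 1) (jd (k + 1)) := (hσ (k + 1)).le_apply
  refine ⟨fun k => σ k (jd k), fun k => τ k (jd k), fun k => A k (jd k), hNk, fun R ε hε => ?_⟩
  -- work at tolerance `ε₁ ≤ min (ε/2) (1/2)`
  set ε₁ : ℝ := min (ε / 2) (1 / 2) with hε₁
  have hε₁0 : 0 < ε₁ := lt_min (half_pos hε) one_half_pos
  have hε₁ε : 2 * ε₁ ≤ ε := by have := min_le_left (ε / 2) (1 / 2); linarith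
  have hε₁1 : ε₁ ≤ 1 / 2 := min_le_right _ _
  filter_upwards [hlim (R + 1) ε₁ hε₁0,
    Filter.eventually_ge_atTop ⌈max (R + 1) (1 / ε₁)⌉₊] with k hk1 hk2
  have hk2' : max (R + 1) (1 / ε₁) ≤ (k : ℝ) := (Nat.le_ceil _).trans (by exact_mod_cast hk2)
  have hkR : R + 1 ≤ k := (le_max_left _ _).trans hk2'
  have hkε : 1 / ((k : ℝ) + 1) ≤ ε₁ := by
    have h1 : 1 / ε₁ ≤ k := (le_max_right _ _).trans hk2'
    rw [div_le_iff₀ hε₁0] at h1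
    rw [div_le_iff₀ (by positivity)]
    nlinarith
  obtain ⟨hAk, hBk⟩ := hJ k (jd k) (hjjJ k)
  obtain ⟨hM1, hM2⟩ := hk1
  set y : Fin (σ k (jd k)) → EuclideanSpace ℝ (Fin 3) :=
    fun i => A k (jd k) (x (σ k (jd k)) i) + τ k (jd k) with hy
  refine ⟨fun p hp hpR => ?_, ?_⟩
  · obtain ⟨a, ha, hap⟩ := hM1 p hp (hpR.trans (by linarith))
    have haR : dist a 0 ≤ k := by
      rw [dist_zero_right] at hpR ⊢
      linarith [norm_le_norm_add_dist' a p]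
    obtain ⟨b, hb, hba⟩ := hAk a ha haR
    refine ⟨b, hb, ?_⟩
    calc dist b p ≤ dist b a + dist a p := dist_triangle _ _ _
      _ ≤ ε₁ + ε₁ := add_le_add (hba.trans hkε) hap
      _ ≤ ε := by linarith
  · rintro b hb hbR
    obtain ⟨p', hp', hbp'⟩ := hBk b hb (hbR.trans (by linarith))
    have hp'R : dist p' 0 ≤ R + 1 := by
      rw [dist_zero_right] at hbR ⊢
      have := norm_le_norm_add_dist' p' b
      rw [dist_comm] at this
      linarith [hbp'.trans hkε, min_le_right (ε / 2) (1 / 2)]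
    obtain ⟨s, hs, hps⟩ := hM2 p' hp' hp'R
    refine ⟨s, hs, ?_⟩
    calc dist b s ≤ dist b p' + dist p' s := dist_triangle _ _ _
      _ ≤ ε₁ + ε₁ := add_le_add (hbp'.trans hkε) hps
      _ ≤ ε := by linarith

/-- **The rotated hull of a ground-state sequence lies in `𝔏`.** For Lennard-Jones ground states
`x N`, every point of the rotated hull of `x` is a local limit of translated ground states
(`IsLocalLimitOfGroundStates lennardJones 3`): rotate the whole family (isometric images of ground
states are ground states, `isGroundState_comp_isometry_iff`). -/
theorem rotHull_isLocalLimitOfGroundStates {x : (N : ℕ) → (Fin N → EuclideanSpace ℝ (Fin 3))}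
    (hx : ∀ N, IsGroundState lennardJones (x N)) {X : Set (EuclideanSpace ℝ (Fin 3))}
    (hX : ∃ (σ : ℕ → ℕ) (τ : ℕ → EuclideanSpace ℝ (Fin 3))
        (A : ℕ → (EuclideanSpace ℝ (Fin 3) ≃ₗᵢ[ℝ] EuclideanSpace ℝ (Fin 3))),
      StrictMono σ ∧ ∀ R ε : ℝ, 0 < ε → ∀ᶠ j in Filter.atTop,
        BallMatch ε R 0 (Set.range fun i => A j (x (σ j) i) + τ j) X) :
    IsLocalLimitOfGroundStates lennardJones 3 X := by
  classical
  obtain ⟨σ, τ, A, hσ, hlim⟩ := hX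
  rw [isLocalLimitOfGroundStates_iff_ballMatch]
  -- rotate the `σ j`-th ground state by `A j` (and the others by anything)
  refine ⟨fun N i => A (Function.invFun σ N) (x N i), σ, τ, fun N => ?_, hσ, fun R ε hε => ?_⟩
  · exact (isGroundState_comp_isometry_iff lennardJones
      (A (Function.invFun σ N)).isometry (x := x N)).2 (hx N)
  · filter_upwards [hlim R ε hε] with j hj
    have hinv : Function.invFun σ (σ j) = j := Function.leftInverse_invFun hσ.injective j
    simp only [hinv]
    exact hj

/-- A uniform minimal distance of Lennard-Jones ground states passes to the rotated hull. -/
theorem rotHull_le_dist {x : (N : ℕ) → (Fin N → EuclideanSpace ℝ (Fin 3))}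
    (hx : ∀ N, IsGroundState lennardJones (x N)) {X : Set (EuclideanSpace ℝ (Fin 3))}
    (hX : ∃ (σ : ℕ → ℕ) (τ : ℕ → EuclideanSpace ℝ (Fin 3))
        (A : ℕ → (EuclideanSpace ℝ (Fin 3) ≃ₗᵢ[ℝ] EuclideanSpace ℝ (Fin 3))),
      StrictMono σ ∧ ∀ R ε : ℝ, 0 < ε → ∀ᶠ j in Filter.atTop,
        BallMatch ε R 0 (Set.range fun i => A j (x (σ j) i) + τ j) X)
    {δ : ℝ} (hsep : ∀ (N : ℕ) (y : Fin N → EuclideanSpace ℝ (Fin 3)), IsGroundState lennardJones y →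
      ∀ i j, i ≠ j → δ ≤ dist (y i) (y j))
    {p q : EuclideanSpace ℝ (Fin 3)} (hp : p ∈ X) (hq : q ∈ X) (hpq : p ≠ q) : δ ≤ dist p q :=
  (rotHull_isLocalLimitOfGroundStates hx hX).le_dist hsep hp hq hpq

/-- Every point of the rotated hull of a Lennard-Jones ground-state sequence is uniformly discrete
(by `LennardJonesMinimalDistance_holds`). -/
theorem rotHull_uniformlyDiscrete {x : (N : ℕ) → (Fin N → EuclideanSpace ℝ (Fin 3))}
    (hx : ∀ N, IsGroundState lennardJones (x N)) {X : Set (EuclideanSpace ℝ (Fin 3))}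
    (hX : ∃ (σ : ℕ → ℕ) (τ : ℕ → EuclideanSpace ℝ (Fin 3))
        (A : ℕ → (EuclideanSpace ℝ (Fin 3) ≃ₗᵢ[ℝ] EuclideanSpace ℝ (Fin 3))),
      StrictMono σ ∧ ∀ R ε : ℝ, 0 < ε → ∀ᶠ j in Filter.atTop,
        BallMatch ε R 0 (Set.range fun i => A j (x (σ j) i) + τ j) X) :
    UniformlyDiscrete X :=
  (rotHull_isLocalLimitOfGroundStates hx hX).uniformlyDiscrete_lennardJones
    LennardJonesMinimalDistance_holds

end Summit.AtomisticToContinuum.Crystallization.Theorems.PeriodicWindowsSketch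

end
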